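import Summits.ResolutionOfSingularities.ResolutionOfSingularities.Theorems.FrobeniusLadderFInjectiveMacaulayficationRMonoidDegreeCount
import Summits.ResolutionOfSingularities.ResolutionOfSingularities.Theorems.FrobeniusLadderFInjectiveMacaulayficationRMonoidSaturated
import HarnessLib

/-!
# T-TOR IN-HOUSE for the recurrent-monoid bed, (FREE′) half 2b: `B` is a `k[θ]`-BASIS of `k[R]` (all degrees) and the monomials span `k[R]`
# (crux `FInjectiveMacaulayfication` stmt-ResolutionOfSingularities-15315, chain w45a; res-L1-w45a-plan-1 R23.13 (2) + GO 06:28:28Z «(CM) = (FREE′)»;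
# seat res-L1-w45a-lead-1 g13; data `…RMonoidFreeDefs`, spanning `…RMonoidSpanning`, per-degree injectivity `…RMonoidDegreeCount`)

[OURS · L1 W4.5a] Support file (`--supports stmt-ResolutionOfSingularities-15315 --as helper`); def-free; UNCONDITIONAL; no named fact; NOT a statement
of any manuscript; replaces the role of NO printed item. AI-written (AI review is weaker than expert review). Nothing of the crux is proved here.

* §1 `isWeightedHomogeneous_theta_*` — under the weight `u = (1,−1,1,1)` (value `1` on every one of the seven generators) the `θ`-images of
  `θ_s`, `bElem i`, `θ^a · bElem i` are weighted-homogeneous of degrees `1`, `bDeg i`, `|a| + bDeg i`; `eq_zero_of_sum_mem_eq_zero` — the degree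
  pieces `M_t = span_k {θ^a · bElem i : |a| + bDeg i = t}` are INDEPENDENT (`Σ_t y_t = 0`, `y_t ∈ M_t` ⇒ `y_t = 0`; weighted homogeneous components + `θ` injective).
* §2 ★★ `bElem_linearIndependent_aeval` — LINEAR INDEPENDENCE over `k[Y₀..Y₃]`: `Σᵢ fᵢ(θ) · bElem i = 0 ⇒ fᵢ = 0` (cut each `fᵢ` into homogeneous
  components, shift by `bDeg i`, apply independence of the pieces and ✓`RMonoidDegreeCount.psi_injective` degree by degree).
* §3 ★ `span_wordElem_wordOf_eq_top` — the monomials `wordElem (wordOf m)` span `k[R]` over `k` (θ-support + ✓`exists_word_of_mem_support`).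
With ✓`RMonoidSpanning.wordElem_wordOf_mem` these say: `B = (1, x₁x₂x₃, x₂x₃x₄, x₁x₂²x₃²x₄, x₂x₄²)` is a BASIS of `k[R]` over the polynomial ring
`k[θ] = k[Y₀..Y₃]` (so `k[R]` is a free `k[Y]`-module of rank `5`); the packaging as `Module.Free` / `Module.Finite` and the Cohen–Macaulay clause at
every prime (✓`FlatIntegralCM`) are in `…RMonoidFull`. [folklore; cite: BrunsHerzog1998, Thm. 2.1.2 (context: Hironaka's criterion)]
-/

-- single-problem summit: the doubled namespace component is forced
set_option linter.dupNamespace false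

noncomputable section

open MvPolynomial

namespace Summit.ResolutionOfSingularities.ResolutionOfSingularities.Theorems.FInjectiveMacaulayfication.RMonoidFreeBasis

open Summit.ResolutionOfSingularities.ResolutionOfSingularities.Theorems.FInjectiveMacaulayfication RMonoidFreeDefs RMonoidStraightening
  RMonoidSpanning RMonoidDegreeCount
open Summit.ResolutionOfSingularities.ResolutionOfSingularities.Theorems.WildQuotientResolution.ToricChart

variable (k : Type) [Field k]

/-! ## §1 Weighted homogeneity and independence of the degree pieces -/

/-- Change of degree along an equality. [plumbing] -/
theorem isWeightedHomogeneous_of_eq {σ M : Type} [AddCommMonoid M] {w : σ → M} {φ : MvPolynomial σ k} {m n : M}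
    (h : IsWeightedHomogeneous w φ m) (hmn : m = n) : IsWeightedHomogeneous w φ n := hmn ▸ h

/-- The four variables are weighted-homogeneous of degrees `1, −1, 1, 1`. [plumbing] -/
theorem isWeightedHomogeneous_X_inl :
    IsWeightedHomogeneous (Sum.elim ![(1 : ℤ), -1, 1, 1] (fun e : PEmpty => nomatch e)) (X (Sum.inl 0) : MvPolynomial (Fin 4 ⊕ PEmpty) k) (1 : ℤ) ∧
    IsWeightedHomogeneous (Sum.elim ![(1 : ℤ), -1, 1, 1] (fun e : PEmpty => nomatch e)) (X (Sum.inl 1) : MvPolynomial (Fin 4 ⊕ PEmpty) k) (-1 : ℤ) ∧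
    IsWeightedHomogeneous (Sum.elim ![(1 : ℤ), -1, 1, 1] (fun e : PEmpty => nomatch e)) (X (Sum.inl 2) : MvPolynomial (Fin 4 ⊕ PEmpty) k) (1 : ℤ) ∧
    IsWeightedHomogeneous (Sum.elim ![(1 : ℤ), -1, 1, 1] (fun e : PEmpty => nomatch e)) (X (Sum.inl 3) : MvPolynomial (Fin 4 ⊕ PEmpty) k) (1 : ℤ) :=
  ⟨by simpa using isWeightedHomogeneous_X k (Sum.elim ![(1 : ℤ), -1, 1, 1] (fun e : PEmpty => nomatch e)) (Sum.inl 0),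
   by simpa using isWeightedHomogeneous_X k (Sum.elim ![(1 : ℤ), -1, 1, 1] (fun e : PEmpty => nomatch e)) (Sum.inl 1),
   by simpa using isWeightedHomogeneous_X k (Sum.elim ![(1 : ℤ), -1, 1, 1] (fun e : PEmpty => nomatch e)) (Sum.inl 2),
   by simpa using isWeightedHomogeneous_X k (Sum.elim ![(1 : ℤ), -1, 1, 1] (fun e : PEmpty => nomatch e)) (Sum.inl 3)⟩

/-- `θ(θ_s)` is weighted-homogeneous of degree `1` for the weight `(1,−1,1,1)`. [OURS · computation] -/
theorem isWeightedHomogeneous_theta_thetaFun (s : Fin 4) :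
    IsWeightedHomogeneous (Sum.elim ![(1 : ℤ), -1, 1, 1] (fun e : PEmpty => nomatch e)) (theta (thetaFun k s)) (1 : ℤ) := by
  obtain ⟨h0, h1, h2, h3⟩ := isWeightedHomogeneous_X_inl k
  fin_cases s
  · exact (show IsWeightedHomogeneous (Sum.elim ![(1 : ℤ), -1, 1, 1] (fun e : PEmpty => nomatch e)) (theta (thetaFun k 0)) (1 : ℤ) by
      rw [theta_thetaFun_0]; exact h0.add (isWeightedHomogeneous_of_eq k ((h1.mul h2).mul h3) (by norm_num)))
  · exact (show IsWeightedHomogeneous (Sum.elim ![(1 : ℤ), -1, 1, 1] (fun e : PEmpty => nomatch e)) (theta (thetaFun k 1)) (1 : ℤ) by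
      rw [theta_thetaFun_1]; exact h2.add (isWeightedHomogeneous_of_eq k (h1.mul (h3.pow 2)) (by norm_num)))
  · exact (show IsWeightedHomogeneous (Sum.elim ![(1 : ℤ), -1, 1, 1] (fun e : PEmpty => nomatch e)) (theta (thetaFun k 2)) (1 : ℤ) by
      rw [theta_thetaFun_2]; exact h3.add (isWeightedHomogeneous_of_eq k ((h0.mul h1).mul h2) (by norm_num)))
  · exact (show IsWeightedHomogeneous (Sum.elim ![(1 : ℤ), -1, 1, 1] (fun e : PEmpty => nomatch e)) (theta (thetaFun k 3)) (1 : ℤ) by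
      rw [theta_thetaFun_3]; exact isWeightedHomogeneous_of_eq k ((h0.mul h1).mul h3) (by norm_num))

/-- `θ(bElem i)` is weighted-homogeneous of degree `bDeg i`. [OURS · computation] -/
theorem isWeightedHomogeneous_theta_bElem (i : Fin 5) :
    IsWeightedHomogeneous (Sum.elim ![(1 : ℤ), -1, 1, 1] (fun e : PEmpty => nomatch e)) (theta (bElem k i)) (bDeg i : ℤ) := by
  obtain ⟨h0, h1, h2, h3⟩ := isWeightedHomogeneous_X_inl k
  fin_cases i
  · exact (show IsWeightedHomogeneous (Sum.elim ![(1 : ℤ), -1, 1, 1] (fun e : PEmpty => nomatch e)) (theta (bElem k 0)) ((bDeg 0 : ℕ) : ℤ) by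
      rw [theta_bElem_0]; exact isWeightedHomogeneous_of_eq k (isWeightedHomogeneous_one k (Sum.elim ![(1 : ℤ), -1, 1, 1] (fun e : PEmpty => nomatch e))) (by simp [bDeg]))
  · exact (show IsWeightedHomogeneous (Sum.elim ![(1 : ℤ), -1, 1, 1] (fun e : PEmpty => nomatch e)) (theta (bElem k 1)) ((bDeg 1 : ℕ) : ℤ) by
      rw [theta_bElem_1]; exact isWeightedHomogeneous_of_eq k ((h0.mul h1).mul h2) (by simp [bDeg]))
  · exact (show IsWeightedHomogeneous (Sum.elim ![(1 : ℤ), -1, 1, 1] (fun e : PEmpty => nomatch e)) (theta (bElem k 2)) ((bDeg 2 : ℕ) : ℤ) by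
      rw [theta_bElem_2]; exact isWeightedHomogeneous_of_eq k ((h1.mul h2).mul h3) (by simp [bDeg]))
  · exact (show IsWeightedHomogeneous (Sum.elim ![(1 : ℤ), -1, 1, 1] (fun e : PEmpty => nomatch e)) (theta (bElem k 3)) ((bDeg 3 : ℕ) : ℤ) by
      rw [theta_bElem_3]; exact isWeightedHomogeneous_of_eq k (((h0.mul (h1.pow 2)).mul (h2.pow 2)).mul h3) (by simp [bDeg]))
  · exact (show IsWeightedHomogeneous (Sum.elim ![(1 : ℤ), -1, 1, 1] (fun e : PEmpty => nomatch e)) (theta (bElem k 4)) ((bDeg 4 : ℕ) : ℤ) by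
      rw [theta_bElem_4]; exact isWeightedHomogeneous_of_eq k (h1.mul (h3.pow 2)) (by simp [bDeg]))

/-- `θ(θ^a · bElem i)` is weighted-homogeneous of degree `|a| + bDeg i`. [OURS · computation] -/
theorem isWeightedHomogeneous_theta_gen (a : Fin 4 → ℕ) (i : Fin 5) :
    IsWeightedHomogeneous (Sum.elim ![(1 : ℤ), -1, 1, 1] (fun e : PEmpty => nomatch e)) (theta (thetaPow k a * bElem k i))
      (((∑ s, a s) + bDeg i : ℕ) : ℤ) := by
  rw [map_mul, thetaPow, map_prod]
  have hprod := IsWeightedHomogeneous.prod Finset.univ (fun s => theta (thetaFun k s ^ a s)) (fun s => ((a s : ℕ) : ℤ))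
    (w := Sum.elim ![(1 : ℤ), -1, 1, 1] (fun e : PEmpty => nomatch e))
    (fun s _ => by rw [map_pow]; exact isWeightedHomogeneous_of_eq k ((isWeightedHomogeneous_theta_thetaFun k s).pow (a s)) (by simp))
  exact isWeightedHomogeneous_of_eq k (hprod.mul (isWeightedHomogeneous_theta_bElem k i)) (by push_cast; ring)

/-- Every element of `M_t` has weighted-homogeneous `θ`-image of degree `t`. [OURS · L1 W4.5a] -/
theorem isWeightedHomogeneous_theta_of_mem (t : ℕ) {x : Ring k PEmpty RMonoidDefs.rDatum}
    (hx : x ∈ Submodule.span k {x | ∃ (i : Fin 5) (a : Fin 4 → ℕ), (∑ s, a s) + bDeg i = t ∧ x = thetaPow k a * bElem k i}) :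
    IsWeightedHomogeneous (Sum.elim ![(1 : ℤ), -1, 1, 1] (fun e : PEmpty => nomatch e)) (theta x) (t : ℤ) := by
  induction hx using Submodule.span_induction with
  | mem x hx =>
    obtain ⟨i, a, ha, rfl⟩ := hx
    exact ha ▸ isWeightedHomogeneous_theta_gen k a i
  | zero => rw [map_zero]; exact isWeightedHomogeneous_zero k _ _
  | add x y _ _ hx hy => rw [map_add]; exact hx.add hy
  | smul c x _ hx =>
    rw [map_smul, Algebra.smul_def, MvPolynomial.algebraMap_eq]
    exact hx.C_mul c

/-- **The degree pieces are independent**: if `y_t ∈ M_t` for `t < T` and `Σ_{t<T} y_t = 0` then every `y_t = 0`. [OURS · L1 W4.5a] -/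
theorem eq_zero_of_sum_mem_eq_zero (T : ℕ) (y : ℕ → Ring k PEmpty RMonoidDefs.rDatum)
    (hy : ∀ t, y t ∈ Submodule.span k {x | ∃ (i : Fin 5) (a : Fin 4 → ℕ), (∑ s, a s) + bDeg i = t ∧ x = thetaPow k a * bElem k i})
    (hsum : ∑ t ∈ Finset.range T, y t = 0) (t₀ : ℕ) (ht₀ : t₀ < T) : y t₀ = 0 := by
  classical
  apply theta_injective
  rw [map_zero]
  have h := congrArg (weightedHomogeneousComponent (Sum.elim ![(1 : ℤ), -1, 1, 1] (fun e : PEmpty => nomatch e)) (t₀ : ℤ))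
    (show ∑ t ∈ Finset.range T, theta (y t) = 0 by rw [← map_sum, hsum, map_zero])
  rw [map_sum, map_zero] at h
  rw [Finset.sum_congr rfl fun t _ => weightedHomogeneousComponent_of_mem
      ((mem_weightedHomogeneousSubmodule _ _ _ _).mpr (isWeightedHomogeneous_theta_of_mem k t (hy t)))] at h
  simp only [Nat.cast_inj] at h
  rw [Finset.sum_ite_eq, if_pos (Finset.mem_range.mpr ht₀)] at h
  exact h

/-! ## §2 Linear independence of `B` over `k[Y₀..Y₃]` -/

/-- Shifted homogeneous components recover `f`: `Σ_{t<T} [bDeg i ≤ t] · f_{(t − bDeg i)} = f` once `T ≥ totalDegree f + 3`. [plumbing] -/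
theorem sum_shifted_homogeneousComponent (f : MvPolynomial (Fin 4) k) (d T : ℕ) (hd : d ≤ 2) (hT : f.totalDegree + 3 ≤ T) :
    ∑ t ∈ Finset.range T, (if d ≤ t then homogeneousComponent (t - d) f else 0) = f := by
  rw [← Finset.sum_range_add_sum_Ico _ (show d ≤ T by omega)]
  rw [Finset.sum_eq_zero (fun t ht => if_neg (by simpa using ht)), zero_add, Finset.sum_Ico_eq_sum_range]
  rw [Finset.sum_congr rfl fun t _ => by rw [if_pos (Nat.le_add_right d t), Nat.add_sub_cancel_left]]
  rw [← Finset.sum_subset (Finset.range_subset_range.mpr (show f.totalDegree + 1 ≤ T - d by omega))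
    (fun t _ ht => homogeneousComponent_eq_zero _ _ (by simpa using ht))]
  exact sum_homogeneousComponent f

/-- ★★ **`B` is linearly independent over `k[θ] = k[Y₀..Y₃]`**: if `Σᵢ fᵢ(θ) · bElem i = 0` in `k[R]` (`fᵢ(θ) = aeval thetaFun fᵢ`) then all
`fᵢ = 0`. [OURS · L1 W4.5a] -/
theorem bElem_linearIndependent_aeval (f : Fin 5 → MvPolynomial (Fin 4) k)
    (hrel : ∑ i, MvPolynomial.aeval (thetaFun k) (f i) * bElem k i = 0) : ∀ i, f i = 0 := by
  classical
  set T : ℕ := (∑ i, (f i).totalDegree) + 3 with hT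
  have hTi : ∀ i, (f i).totalDegree + 3 ≤ T := fun i => by
    have := Finset.single_le_sum (fun j _ => Nat.zero_le ((f j).totalDegree)) (Finset.mem_univ i)
    omega
  -- the degree-`t` slices of `f`
  set g : ℕ → Fin 5 → MvPolynomial (Fin 4) k := fun t i => if bDeg i ≤ t then homogeneousComponent (t - bDeg i) (f i) else 0 with hg
  have hdeg : ∀ i, bDeg i ≤ 2 := by decide
  have hghom : ∀ t i, (g t i).IsHomogeneous (t - bDeg i) := by
    intro t i
    simp only [hg]
    split_ifs
    · exact homogeneousComponent_isHomogeneous _ _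
    · exact isHomogeneous_zero _ _ _
  have hglow : ∀ t i, t < bDeg i → g t i = 0 := fun t i h => by simp only [hg]; rw [if_neg (by omega)]
  -- `y_t := Σ_i g_t i (θ) · bElem i ∈ M_t`
  set y : ℕ → Ring k PEmpty RMonoidDefs.rDatum := fun t => ∑ i, MvPolynomial.aeval (thetaFun k) (g t i) * bElem k i with hy
  have hymem : ∀ t, y t ∈ Submodule.span k
      {x | ∃ (i : Fin 5) (a : Fin 4 → ℕ), (∑ s, a s) + bDeg i = t ∧ x = thetaPow k a * bElem k i} := by
    intro t
    refine Submodule.sum_mem _ fun i _ => ?_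
    rw [aeval_mul_bElem_eq_sum]
    refine Submodule.sum_mem _ fun a ha => Submodule.smul_mem _ _ (gen_mem k i ⇑a t ?_)
    have h1 := sum_eq_of_mem_support_isHomogeneous k (hghom t i) ha
    by_cases hle : bDeg i ≤ t
    · omega
    · exfalso; rw [hglow t i (by omega)] at ha; simp at ha
  -- `Σ_{t<T} y_t = Σ_i f_i(θ) · bElem i = 0`
  have hysum : ∑ t ∈ Finset.range T, y t = 0 := by
    rw [← hrel]
    simp only [hy]
    rw [Finset.sum_comm]
    refine Finset.sum_congr rfl fun i _ => ?_
    rw [← Finset.sum_mul, ← map_sum]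
    congr 2
    exact sum_shifted_homogeneousComponent k (f i) (bDeg i) T (hdeg i) (hTi i)
  -- each slice vanishes, hence each shifted homogeneous component of `f i` vanishes
  have hg0 : ∀ t < T, ∀ i, g t i = 0 := fun t ht =>
    psi_injective k t (g t) (hghom t) (hglow t) (eq_zero_of_sum_mem_eq_zero k T y hymem hysum t ht)
  intro i
  rw [← sum_shifted_homogeneousComponent k (f i) (bDeg i) T (hdeg i) (hTi i)]
  exact Finset.sum_eq_zero fun t ht => hg0 t (Finset.mem_range.mp ht) i

/-! ## §3 The monomials span `k[R]` over `k` -/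

/-- For `P = PEmpty` an exponent vector is `ιexp` of its distinguished part. [plumbing] -/
theorem eq_ιexp_dist (μ : (Fin 4 ⊕ PEmpty) →₀ ℕ) : μ = ιexp PEmpty (dist μ) := by
  ext v
  rcases v with s | e
  · rw [ιexp_inl]; rfl
  · exact nomatch e

/-- Every word has the exponent of some `wordOf m`. [plumbing] -/
theorem exists_wordOf_eq (w : Word 4 4) : ∃ m : Fin 7 → ℕ, wordExp RMonoidDefs.rDatum (wordOf m) = wordExp RMonoidDefs.rDatum w := by
  refine ⟨![w.wp 0, w.wp 2, w.wp 3, w.wm 0, w.wm 1, w.wm 2, w.wm 3], ?_⟩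
  rw [wordExp_wordOf]
  funext s
  fin_cases s <;> simp [RMonoidSaturated.wordExp_rDatum_zero, RMonoidSaturated.wordExp_rDatum_one, RMonoidSaturated.wordExp_rDatum_two,
    RMonoidSaturated.wordExp_rDatum_three]

/-- ★ **The monomials `wordElem (wordOf m)` span `k[R]` over `k`.** [OURS · L1 W4.5a] -/
theorem span_wordElem_wordOf_eq_top :
    Submodule.span k (Set.range fun m : Fin 7 → ℕ => wordElem k PEmpty RMonoidDefs.rDatum (wordOf m)) = ⊤ := by
  classical
  rw [eq_top_iff]
  rintro r -
  -- every monomial of `θ r` is `θ` of a `wordElem (wordOf m)`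
  have hmono : ∀ μ ∈ (theta r).support, ∃ m : Fin 7 → ℕ,
      theta (wordElem k PEmpty RMonoidDefs.rDatum (wordOf m)) = monomial μ 1 := by
    intro μ hμ
    obtain ⟨w, hw⟩ := exists_word_of_mem_support r μ hμ
    obtain ⟨m, hm⟩ := exists_wordOf_eq w
    refine ⟨m, ?_⟩
    rw [theta_wordElem_wordOf, hm, hw, ← eq_ιexp_dist]
  choose m hm using hmono
  set z : Ring k PEmpty RMonoidDefs.rDatum :=
    ∑ μ ∈ (theta r).support.attach, coeff μ.1 (theta r) • wordElem k PEmpty RMonoidDefs.rDatum (wordOf (m μ.1 μ.2)) with hz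
  have hzr : z = r := by
    apply theta_injective
    rw [hz, map_sum]
    conv_rhs => rw [(theta r).as_sum, ← Finset.sum_attach]
    refine Finset.sum_congr rfl fun μ _ => ?_
    rw [map_smul, hm μ.1 μ.2, smul_monomial, smul_eq_mul, mul_one]
  rw [← hzr, hz]
  exact Submodule.sum_mem _ fun μ _ => Submodule.smul_mem _ _ (Submodule.subset_span ⟨m μ.1 μ.2, rfl⟩)

end Summit.ResolutionOfSingularities.ResolutionOfSingularities.Theorems.FInjectiveMacaulayfication.RMonoidFreeBasis

end
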